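import Literature.NumberTheory.Transcendental.L2HodgeTheoryExactCoexactProofs
import HarnessLib

/-!
# Harmonic forms are `L²`-orthogonal to co-exact forms (Warner, Thm. 6.8): proofs

Topic: the real `L²` Hodge theory of
`Literature/NumberTheory/Transcendental/L2HodgeTheory.lean` (the `L²` product
`Literature.Geometry.Kaehler.MForm.l2Inner o α β = ∫_M ⟪α, β⟫ vol_o` and the named fact
`Literature.NumberTheory.Transcendental.isL2Orthogonal_harmonicForms_coexact`), continuing the
sibling proof file `L2HodgeTheoryExactCoexactProofs.lean` (Prop. 6.2 in `L²` form,
`MForm.l2Inner_mextDeriv_left_of_isSmoothForm`, and `exists_eq_mcoderiv_of_mem_span_mcoderiv`).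
Source: F. W. Warner, *Foundations of Differentiable Manifolds and Lie Groups*, GTM 94 (1983),
Ch. 6 — standing hypothesis p. 220: "Throughout this chapter, `M` will be a compact oriented
Riemannian manifold of dimension `n`"; `⟨α, β⟩ = ∫_M α ∧ *β` (6.1 (5)); Prop. 6.2 (`δ` is the
adjoint of `d`); Prop. 6.3 (`Δα = 0 ↔ dα = 0 ∧ δα = 0`); Def. 6.7 (`H^p`); Thm. 6.8
(pp. 222–223), the orthogonal direct sum `E^p(M) = d(E^{p-1}) ⊕ δ(E^{p+1}) ⊕ H^p`, whose
orthogonality relations "follow from 6.1(3), 6.2, and 6.3" (proof, p. 223). (The bib key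
`Warner1983` used in `L2HodgeTheory.lean` is the interim stub for the same book, `WarnerGTM94`.)

## Main statements (all proved)

* `mextDeriv_eq_zero_of_isHarmonicForm`: harmonic forms are closed, in every degree (Prop. 6.3;
  in degree `0`, `Δf = δdf = 0 ⇒ ‖df‖² = ⟨f, δdf⟩ = 0`).
* `l2Inner_mcoderiv_eq_zero_of_isHarmonicForm`: `⟨η, δγ⟩ = ⟨dη, γ⟩ = 0` for `η` harmonic and
  `γ ∈ E^{k+1}(M)` (Prop. 6.2 and 6.3).
* `isL2Orthogonal_harmonicForms_coexact_of_isSmoothForm` — **Thm. 6.8, `H^p ⟂ δ(E^{p+1})`**: on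
  a compact oriented Riemannian manifold without boundary (Hausdorff, `C^∞`, smooth metric,
  `vol_o` smooth), `harmonicForms o h` is `L²`-orthogonal to the span of the co-exact forms `δγ`,
  `γ ∈ E^{k+1}(M)`.
* `isL2Orthogonal_harmonicForms_coexact_of_compactSpace`: under the intended instances the named
  fact `isL2Orthogonal_harmonicForms_coexact o` of `L2HodgeTheory.lean` holds as declared.

## The named fact `isL2Orthogonal_harmonicForms_coexact` is mis-stated (provefact pass, 2026-08-15)

That `def … : Prop` was written inside `section Closed` of `L2HodgeTheory.lean`, after
`variable [CompactSpace M] [I.Boundaryless] [IsContinuousRiemannianBundle E _]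
[IsContMDiffRiemannianBundle I ∞ E _]`; but a `def` keeps only the section variables its
statement uses, so (checked with `#check @isL2Orthogonal_harmonicForms_coexact`) its elaborated
signature binds `[T2Space M] [SigmaCompactSpace M] [IsManifold I ∞ M] [RiemannianBundle _] (o)
{k m}` and none of those four instances: it quantifies over *non-compact* manifolds, manifolds
with boundary and fibre metrics of no regularity. In that generality it is **false**, not merely
unproved: on `M = ℝⁿ` (`n ≥ 1`, flat, standard orientation, `k = 0`) the constant function `1`
is harmonic (`Δ1 = δd1 = 0`) and every bump function `b ≥ 0`, `b ≢ 0`, is co-exact,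
`b = δ(g dx₁)` with `g(x) = -∫_{-∞}^{x₁} b dt` (`δ = -⋆d⋆` on `1`-forms); since `b` has compact
support, only finitely many functions of the (locally finite) partition of unity defining
`MForm.integral` meet it — whichever partition `Classical.choose` picked — so
`⟪1, b⟫_{L²} = |vol_o(e)| ∫_{ℝⁿ} b dλ > 0`. (With boundary it fails already on `[0, 1]`:
`⟪1, δ(g dx)⟫ = g(0) - g(1)`; cf. the disk example in `L2HodgeTheoryExactCoexactProofs.lean`.)
Warner's theorem carries compactness and empty boundary as standing hypotheses (p. 220; Stokes
enters through Prop. 6.2) and a `C^∞` metric. Following the provefact protocol (a mis-stated fact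
is corrected under a new name, never edited in place, and no `_holds` is claimed for it), the
result is proved here with the hypotheses Warner uses, as the usable theorem
`isL2Orthogonal_harmonicForms_coexact_of_isSmoothForm` (section instances
`[CompactSpace M] [I.Boundaryless]`, continuous and `C^∞` metric), together with the bridge
`…_of_compactSpace` to the declared `Prop`; the corrected *closed* named fact (all hypotheses
bound inside the statement) and its discharge follow in the reviewed companion
`L2HodgeTheoryHarmonicCoexactFact.lean`. The same dropped-instance defect affects every `def` of
`section Closed` of `L2HodgeTheory.lean` (listed in `L2HodgeTheoryExactCoexactProofs.lean`).

## Proof (as printed, Warner pp. 220–223)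

For `η ∈ H^k` and `γ ∈ E^{k+1}(M)`: `⟨η, δγ⟩ = ⟨dη, γ⟩` (Prop. 6.2,
`MForm.l2Inner_mextDeriv_left_of_isSmoothForm`, i.e. Stokes applied to `d(η ∧ ⋆γ)`), and `dη = 0`
because harmonic forms are closed (Prop. 6.3, `isHarmonicForm_iff_closed_and_coclosed`; in degree
`0` directly from Prop. 6.2 and positive definiteness,
`eq_zero_of_integral_wedge_hodgeStar_self_eq_zero`; in dimension `0` there are no `1`-forms).
The two spans reduce to these generators: `harmonicForms o h = span {harmonic}` consists of
harmonic forms (`mem_harmonicForms_iff_of_contMDiffMetric`, linearity of `Δ` on `E^k(M)`, 6.1 /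
Def. 6.7) and `span (δ '' E^{k+1}) = δ(E^{k+1})` (`exists_eq_mcoderiv_of_mem_span_mcoderiv`,
linearity of `δ`). Every ingredient is a proved theorem of the tree; no named fact is assumed.

## References

* F. W. Warner, *Foundations of Differentiable Manifolds and Lie Groups*, GTM 94, Springer
  (1983): 6.1 (p. 220), Prop. 6.2 (pp. 220–221), Prop. 6.3 (p. 221), Def. 6.7 (p. 222),
  Thm. 6.8 and its proof (pp. 222–224).
* J. Jost, *Riemannian Geometry and Geometric Analysis*, §3.4 (Hodge decomposition).

## Verdict clean-up note (2026-08-15)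

The named fact `isL2Orthogonal_harmonicForms_coexact` is now an `@[deprecated]` record of
`L2HodgeTheory.lean` (mis-stated, resp. refuted as stated: a `def` does not abstract the unused
section instances it was written under; the corrected statements are the ones proved or named in
this file and in the records' docstrings). The declaration
`isL2Orthogonal_harmonicForms_coexact_of_compactSpace` names the record on purpose, so
`linter.deprecated` is silenced on exactly that declaration (REMOVE-WHEN the records are deleted
from `L2HodgeTheory.lean`).
-/

noncomputable section

open scoped Manifold ContDiff Topology
open Bundle Module Set Function
open Literature.Geometry.Kaehler

namespace Literature.NumberTheory.Transcendental

variable {E : Type*} [NormedAddCommGroup E] [NormedSpace ℝ E] [FiniteDimensional ℝ E]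
  {n : ℕ} [Fact (finrank ℝ E = n)] [MeasurableSpace E] [BorelSpace E]
  {H : Type*} [TopologicalSpace H] {I : ModelWithCorners ℝ E H}
  {M : Type*} [TopologicalSpace M] [ChartedSpace H M] [T2Space M] [CompactSpace M]
  [I.Boundaryless] [IsManifold I ∞ M] [RiemannianBundle (fun x : M ↦ TangentSpace I x)]
  [IsContinuousRiemannianBundle E (fun x : M ↦ TangentSpace I x)]
  [IsContMDiffRiemannianBundle I ∞ E (fun x : M ↦ TangentSpace I x)]
  (o : (x : M) → Orientation ℝ (TangentSpace I x) (Fin n)) {k m : ℕ}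

/-- **Harmonic forms are closed**, in every degree: on a compact oriented Riemannian manifold
without boundary (Hausdorff, `C^∞`, `C^∞` metric, `vol_o` smooth), `Δη = 0` for a smooth `k`-form
`η` (`k + m = n`) implies `dη = 0`. In positive degree this is half of Prop. 6.3
(`isHarmonicForm_iff_closed_and_coclosed`); in degree `0`, `Δf = δdf`, so
`‖df‖² = ∫ df ∧ ⋆df = ∫ f ∧ ⋆δdf = 0` by Prop. 6.2 (`integral_mextDeriv_wedge_hodgeStar`) and
`df = 0` by positive definiteness (`eq_zero_of_integral_wedge_hodgeStar_self_eq_zero`); in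
dimension `n = 0` there are no `1`-forms (`mextDeriv_eq_zero_of_top_degree`). Warner (1983),
Prop. 6.3, p. 221. [cite: WarnerGTM94, Prop. 6.3, p. 221] -/
theorem mextDeriv_eq_zero_of_isHarmonicForm (ho : IsSmoothForm (riemannianVolumeForm o))
    (h : k + m = n) {η : MForm I M ℝ k} (hη : IsHarmonicForm o h η) : mextDeriv η = 0 := by
  rcases k with - | j
  · rcases m with - | m'
    · obtain rfl : n = 0 := by omega
      exact mextDeriv_eq_zero_of_top_degree η
    · have hds : IsSmoothForm (mextDeriv η) :=
        isSmoothForm_mextDeriv (inChart_mextDeriv_holds I M ℝ) hη.1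
      have hΔ : mcoderiv o (show (0 + 1) + m' = n by omega) (mextDeriv η) = 0 := hη.2
      have hadj := integral_mextDeriv_wedge_hodgeStar o ho (show (0 + 1) + m' = n by omega) hη.1 hds
      rw [hΔ, map_zero, MForm.wedge_zero, MForm.castDeg_zero, MForm.zero_integral] at hadj
      exact eq_zero_of_integral_wedge_hodgeStar_self_eq_zero o ho _ hds hadj
  · exact ((isHarmonicForm_iff_closed_and_coclosed o ho h hη.1).1 hη).1

/-- **`⟨η, δγ⟩ = 0` for `η` harmonic**: on a compact oriented Riemannian manifold without boundary
(smooth metric, `vol_o` smooth) a harmonic `k`-form `η` (`h : k + (m + 1) = n`) is `L²`-orthogonal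
to every co-exact form `δγ`, `γ` a smooth `(k+1)`-form, since `⟨η, δγ⟩ = ⟨dη, γ⟩` (Prop. 6.2,
`MForm.l2Inner_mextDeriv_left_of_isSmoothForm`) and `dη = 0` (Prop. 6.3,
`mextDeriv_eq_zero_of_isHarmonicForm`). Warner (1983), proof of Thm. 6.8, p. 223 ("follow from
6.1(3), 6.2, and 6.3"). [cite: WarnerGTM94, Thm. 6.8, p. 223] -/
theorem l2Inner_mcoderiv_eq_zero_of_isHarmonicForm (ho : IsSmoothForm (riemannianVolumeForm o))
    (h : k + (m + 1) = n) {η : MForm I M ℝ k} (hη : IsHarmonicForm o h η)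
    {γ : MForm I M ℝ (k + 1)} (hγ : IsSmoothForm γ) :
    MForm.l2Inner o η (mcoderiv o (show (k + 1) + m = n by omega) γ) = 0 := by
  rw [← MForm.l2Inner_mextDeriv_left_of_isSmoothForm o ho (show (k + 1) + m = n by omega) hη.1 hγ,
    mextDeriv_eq_zero_of_isHarmonicForm o ho h hη]
  simpa using MForm.l2Inner_smul_left o (0 : ℝ) (0 : MForm I M ℝ (k + 1)) γ

/-- **Harmonic forms are `L²`-orthogonal to co-exact forms** (Warner (1983), Thm. 6.8,
pp. 222–223: the summands `δ(E^{p+1})` and `H^p` of the Hodge decomposition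
`E^p(M) = d(E^{p-1}) ⊕ δ(E^{p+1}) ⊕ H^p` are orthogonal). On a compact oriented Riemannian
manifold without boundary — Hausdorff, `C^∞`, `C^∞` metric, `vol_o` smooth (`o` locally
constant) — the space `harmonicForms o h` of harmonic `k`-forms (`h : k + (m + 1) = n`) is
`L²`-orthogonal to the span of the co-exact forms `δγ`, `γ` a smooth `(k+1)`-form (the
codifferential typed as in `RiemannianHodge.lean`, `(k + 1) + m = n`). Proof as printed:
an element of `harmonicForms o h = span {harmonic}` is harmonic
(`mem_harmonicForms_iff_of_contMDiffMetric`: `Δ` is linear on `E^k(M)`, 6.1 / Def. 6.7), an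
element of the span of `δ(E^{k+1})` is some `δγ` (`exists_eq_mcoderiv_of_mem_span_mcoderiv`: `δ`
is linear), and `⟨η, δγ⟩ = ⟨dη, γ⟩ = 0` by Prop. 6.2 and Prop. 6.3
(`l2Inner_mcoderiv_eq_zero_of_isHarmonicForm`). This is the statement of the named fact
`isL2Orthogonal_harmonicForms_coexact` with the hypotheses Warner uses (see the module docstring
for why that `def`, which drops them, is false as declared).
[cite: WarnerGTM94, Thm. 6.8, pp. 222–223] -/
theorem isL2Orthogonal_harmonicForms_coexact_of_isSmoothForm
    (ho : IsSmoothForm (riemannianVolumeForm o)) (h : k + (m + 1) = n) :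
    IsL2Orthogonal o (harmonicForms o h : Set (MForm I M ℝ k))
      (Submodule.span ℝ (mcoderiv o (show (k + 1) + m = n by omega) ''
        (smoothForms I M ℝ (k + 1) : Set (MForm I M ℝ (k + 1))))) := by
  intro η hη β hβ
  have hη' : IsHarmonicForm o h η := (mem_harmonicForms_iff_of_contMDiffMetric o ho h η).1 hη
  obtain ⟨γ, hγ, rfl⟩ := exists_eq_mcoderiv_of_mem_span_mcoderiv o ho _ hβ
  exact l2Inner_mcoderiv_eq_zero_of_isHarmonicForm o ho h hη' hγ

-- names the `@[deprecated]` record `isL2Orthogonal_harmonicForms_coexact` on purpose (verdict clean-up 2026-08-15); REMOVE-WHEN the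
-- record is deleted from `L2HodgeTheory.lean`
set_option linter.deprecated false in
/-- **Bridge to the named fact as declared.** In the presence of the intended instances
(`CompactSpace M`, `I.Boundaryless`, continuous and `C^∞` metric — the section variables the
`def` silently dropped), the named fact `isL2Orthogonal_harmonicForms_coexact o` of
`L2HodgeTheory.lean` holds (its body quantifies `ho` and `h` itself). Warner (1983), Thm. 6.8,
pp. 222–223. [cite: WarnerGTM94, Thm. 6.8, pp. 222–223] -/
theorem isL2Orthogonal_harmonicForms_coexact_of_compactSpace :
    isL2Orthogonal_harmonicForms_coexact (k := k) (m := m) o :=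
  fun ho h ↦ isL2Orthogonal_harmonicForms_coexact_of_isSmoothForm o ho h

end Literature.NumberTheory.Transcendental
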